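import Literature.AlgebraicGeometry.Frobenioids.IsoSubanchorNotIsotropic
import Literature.AlgebraicGeometry.Frobenioids.ArchimedeanIsoSubanchors
import HarnessLib

/-!
# Frobenioids I §0 / II Prop. 3.5: two bookkeeping criteria for anchors (proof-only)

Mochizuki, *The geometry of Frobenioids I: the general theory*, Kyushu J. Math. **62** (2008), §0
p. 18 (anchors: "only finitely many isomorphism classes of objects of `^A 𝒞` arise from irreducible
arrows `A → B`") [cite: MochizukiFrdI2008, §0 p.18], as USED in *Frobenioids II*, proof of Prop. 3.5
(ii)/(iii), kurims p. 35 [cite: MochizukiFrdII2008, Prop 3.5 (ii) p.34]: "the finiteness of the collection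
of isomorphism classes of `^C F` arising from [irreducible] `φ` which are pull-back morphisms
(respectively, …) then follows immediately from the fact that `C_D` is an anchor of `D[ℂ]`
(respectively, from Lemma 3.2 …)" — i.e. (a) irreducible arrows out of `C` fall into finitely many
KINDS, (b) for each kind the isomorphism classes are finite, and for the pull-back kind (c) finiteness
is PULLED BACK along a functor (`Base`) that carries these arrows to irreducible arrows out of an anchor
and reflects isomorphism classes on them.

PROOF-ONLY companion (abc-iut cell, layer L1, generic plumbing for SUBDAG S4 rows P35-L05
`NonIsotropicOverAnchorIsAnchor` and P35-L06 `AngloidRCIsoSubanchor`; seat abc-iut-w4-d027). Contents: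

* `isAnchor_of_kinds` — (a)+(b): if every irreducible arrow out of `C` is of kind `K₁` or `K₂` and each
  kind contributes finitely many isomorphism classes of `^C 𝒳`, then `C` is an anchor;
* `finite_isoClasses_of_functor` — (c): for a functor `Φ : 𝒳 → 𝒴` and a kind `K` of arrows out of `C`
  such that `Φ` maps `K`-arrows to irreducible arrows and reflects isomorphism (of objects under `C`)
  on `K`-arrows, the `K`-classes are finite as soon as `Φ(C)` is an anchor of `𝒴`;
* `ArchFrd.prop35ii_of_forward` — [FrdII] Prop. 3.5 (ii) reduced to its forward half: the backward
  half "iso-subanchor ⟹ non-isotropic" is [FrdI] Rem. 3.1.1 (`not_isIsotropic_of_isIsoSubanchor`,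
  abc-iut-L1 `IsoSubanchorNotIsotropic.lean`) for every Frobenioid, so the schema `Prop35ii G F` follows
  from "non-isotropic ⟹ iso-subanchor" alone (the content of SUBDAG rows P35-L04/L05).

Generic category theory; no new definitions; no statement of either paper is strengthened; nothing here
bears on [IUTchIII] Cor. 3.12.
-/

namespace Literature.AlgebraicGeometry.Frobenioids

open CategoryTheory

universe v v₁ v₂ u u₁ u₂

section Kinds

variable {𝒳 : Type u₁} [Category.{v₁} 𝒳] {𝒴 : Type u₂} [Category.{v₂} 𝒴]

/-- **Anchor by kinds** ([FrdII] proof of Prop. 3.5 (ii)/(iii), p. 35: "`φ` is either a pull-back morphism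
or an isometric pre-step … the finiteness … follows …"): if every irreducible arrow out of `C` is of kind
`K₁` or of kind `K₂`, and each kind yields finitely many isomorphism classes of `^C 𝒳`, then `C` is an
anchor. [cite: MochizukiFrdII2008, Prop 3.5 (ii) p.34] -/
theorem isAnchor_of_kinds (C : 𝒳) (K₁ K₂ : ∀ ⦃Y : 𝒳⦄, (C ⟶ Y) → Prop)
    (hcover : ∀ ⦃Y : 𝒳⦄ (f : C ⟶ Y), IsIrreducibleHom f → K₁ f ∨ K₂ f)
    (h₁ : Set.Finite {x : Quotient (isIsomorphicSetoid (Under C)) | ∃ f : Under C, K₁ f.hom ∧ Quotient.mk _ f = x})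
    (h₂ : Set.Finite {x : Quotient (isIsomorphicSetoid (Under C)) | ∃ f : Under C, K₂ f.hom ∧ Quotient.mk _ f = x}) :
    IsAnchor C := by
  refine (h₁.union h₂).subset ?_
  rintro x ⟨f, hf, rfl⟩
  rcases hcover f.hom hf with h | h
  · exact Or.inl ⟨f, h, rfl⟩
  · exact Or.inr ⟨f, h, rfl⟩

/-- The map on isomorphism classes of coslice categories induced by a functor.
[cite: MochizukiFrdI2008, §0 p.18] -/
theorem exists_quotientMap_under (Φ : 𝒳 ⥤ 𝒴) (C : 𝒳) :
    ∃ q : Quotient (isIsomorphicSetoid (Under C)) → Quotient (isIsomorphicSetoid (Under (Φ.obj C))),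
      ∀ f : Under C, q (Quotient.mk _ f) = Quotient.mk _ ((Under.post Φ).obj f) :=
  ⟨Quotient.map' (Under.post Φ).obj fun _ _ ⟨i⟩ => ⟨(Under.post Φ).mapIso i⟩, fun _ => rfl⟩

/-- **Finiteness pulled back along a functor** ([FrdII] p. 35: "follows immediately from the fact that
`C_D` is an anchor of `D[ℂ]`"): let `K` be a kind of arrows out of `C` which `Φ` carries to irreducible
arrows out of `Φ(C)`, and on which `Φ` reflects isomorphism of objects under `C`; if `Φ(C)` is an anchor
then the `K`-classes of `^C 𝒳` are finite. [cite: MochizukiFrdII2008, Prop 3.5 (ii) p.34] -/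
theorem finite_isoClasses_of_functor (Φ : 𝒳 ⥤ 𝒴) (C : 𝒳) (K : ∀ ⦃Y : 𝒳⦄, (C ⟶ Y) → Prop)
    (hirr : ∀ ⦃Y : 𝒳⦄ (f : C ⟶ Y), K f → IsIrreducibleHom (Φ.map f))
    (hrefl : ∀ (f g : Under C), K f.hom → K g.hom →
      Nonempty ((Under.post Φ).obj f ≅ (Under.post Φ).obj g) → Nonempty (f ≅ g))
    (hanch : IsAnchor (Φ.obj C)) :
    Set.Finite {x : Quotient (isIsomorphicSetoid (Under C)) | ∃ f : Under C, K f.hom ∧ Quotient.mk _ f = x} := by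
  obtain ⟨q, hq⟩ := exists_quotientMap_under Φ C
  refine Set.Finite.of_finite_image (f := q) (hanch.subset ?_) ?_
  · rintro y ⟨x, ⟨f, hf, rfl⟩, rfl⟩
    refine ⟨(Under.post Φ).obj f, ?_, (hq f).symm⟩
    exact hirr f.hom hf
  · rintro x ⟨f, hf, rfl⟩ x' ⟨g, hg, rfl⟩ hfg
    rw [hq, hq] at hfg
    obtain ⟨i⟩ := hrefl f g hf hg (Quotient.exact hfg)
    exact Quotient.sound ⟨i⟩

end Kinds

namespace ArchFrd

variable {D : Type u} [Category.{v} D] (G : D ⥤ ArchBase)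
  {Φ : Dᵒᵖ ⥤ CommMonCat.{0}} {X : Type u₁} [Category.{v₁} X] (F : X ⥤ ElemFrobenioid Φ)

/-- **[FrdII] Prop. 3.5 (ii) reduced to its forward half**: for a Frobenioid `F`, "iso-subanchor ⟹
non-isotropic" is [FrdI] Rem. 3.1.1 (`PreFrobenioid.not_isIsotropic_of_isIsoSubanchor`), so the schema
`Prop35ii G F` ("non-isotropic ⟺ iso-subanchor", under `D` of RC-iso-subanchor type) follows from the
forward implication alone — the content of SUBDAG rows P35-L04/L05 (print p. 34 l. 46 – p. 35 l. 27:
"By [Mzk5], Remark 3.1.1, it suffices to show that every non-isotropic … `A` is an iso-subanchor").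
[cite: MochizukiFrdII2008, Prop 3.5 (ii) p.34] -/
theorem prop35ii_of_forward (hF : PreFrobenioid.IsFrobenioid F)
    (h : RC.IsOfRCIsoSubanchorType G →
      ∀ A : X, ¬ PreFrobenioid.IsIsotropic F A → IsIsoSubanchor A) :
    Prop35ii G F := fun hD A =>
  ⟨h hD A, fun hA => PreFrobenioid.not_isIsotropic_of_isIsoSubanchor hF hA⟩

end ArchFrd

end Literature.AlgebraicGeometry.Frobenioids
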